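import Mathlib
import Summits.ValiantsHypothesis.ValiantsHypothesis.Theorems.RigidityForcesSymmetryRigidMinimalReprStubTightStructurePrep
import Summits.ValiantsHypothesis.ValiantsHypothesis.Theorems.RigidityForcesSymmetryRigidMinimalReprStubEigenbasis
import Summits.ValiantsHypothesis.ValiantsHypothesis.Theorems.RigidityForcesSymmetryRigidMinimalReprStubSourceBasis
import Summits.ValiantsHypothesis.ValiantsHypothesis.Theorems.RigidityForcesSymmetryRigidMinimalReprStubLevelCard

/-!
# Route RigidityForcesSymmetry — crux `RigidMinimalRepr` (stmt-ValiantsHypothesis-4163), refutation line: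
# the graded monomial normal form in the TIGHT case `n = 2^m - 1` (`stub_tightStructure`)

Lead stub of the refutation skeleton (line `registered`, run to the negative side).  A two-sided-torus-
equivariant affine determinantal representation `Ã` of `perm_m` (`m ≥ 3`) of size `n = 2^m - 1` is put in a
graded monomial normal form `g Ã h⁻¹` by two bases read off ONE generic torus element and its exact lift
`(P, Q)` (`tightStructure_prep`):

* the tight count (`stub_levelCard`): the present pairs `(I, J)` (non-zero generalised eigenspaces of `P` at
  the weight `γ₀ ∏_I p ∏_J q`) number exactly `n`, all with `|I| ≥ 1`;
* hence `P` has an eigenbasis indexed by the present pairs (`stub_eigenbasis`), and the source side has the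
  matching basis `k₀` (kernel line, `Q`-weight `γ₀`), `c_{IJ}` with `Λ c_{IJ} = b_{IJ}`, `Q c_{IJ} = wt · c_{IJ}`
  for the non-top pairs (`stub_sourceBasis`);
* in these bases (`g`, `h` the change-of-basis matrices) a constant entry `(r, c)` forces equal exponents,
  an `x_{kl}`-entry forces `ρ r = θ c + st k l` (weight shift `P A_{kl} = p_k q_l A_{kl} Q` and unique
  factorisation), the level-1 rows `({k}, {σ k})` exist for every `σ`, and each level-1 row has the unit
  constant `1` in its own column.

Convention of the tree's LR17 files: `m` = size of the permanent, `n` = size of the matrix.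
-/

open Matrix MvPolynomial Finset Module.End
open scoped Kronecker
open Literature.Computability.AlgebraicComplexity LRPencil

-- the mandated summit-side namespace repeats a component by design (single-problem summit)
set_option linter.dupNamespace false

namespace Summit.ValiantsHypothesis.ValiantsHypothesis.Theorems.RigidityForcesSymmetryRigidMinimalRepr

noncomputable section

/-- **Tight structure (graded monomial normal form).** A two-sided-torus-equivariant affine determinantal
representation of `perm_m` (`m ≥ 3`) of the minimal conceivable size `n = 2^m - 1` becomes, after a constant
change of bases `g · Ã · h⁻¹`, a graded monomial matrix: rows carry `0/1` exponents `ρ`, columns carry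
`0/1` exponents `θ` (injective, one pivot column of exponent `0`), a constant entry forces `ρ r = θ c`, an
`x_{kl}` entry forces `ρ r = θ c + st k l`; the level-1 rows serve every permutation and each has its unit
diagonal constant. [cite: LandsbergRessayre2017, §6] -/
theorem stub_tightStructure {m n : ℕ} (hm : 3 ≤ m) (hn : n = 2 ^ m - 1)
    {A : Matrix (Fin n) (Fin n) (MvPolynomial (Fin m × Fin m) ℂ)}
    (hA : IsEquivariantDetRepr (Subgroup.closure {γ : GL (Fin m × Fin m) ℂ | ∃ d e : Fin m → ℂ,
        (γ : Matrix (Fin m × Fin m) (Fin m × Fin m) ℂ) = Matrix.diagonal (fun p => d p.1 * e p.2)})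
      (perPoly (Fin m) ℂ) A) :
    ∃ (g h : GL (Fin n) ℂ) (ρ θ : Fin n → (Fin m ⊕ Fin m → ℕ)) (c₀ : Fin n),
      (∀ r x, ρ r x ≤ 1) ∧ (∀ c x, θ c x ≤ 1) ∧ Function.Injective θ ∧ θ c₀ = 0 ∧
      (∀ r c, constPart ((g : Matrix (Fin n) (Fin n) ℂ).map C * A *
          ((h⁻¹ : GL (Fin n) ℂ) : Matrix (Fin n) (Fin n) ℂ).map C) r c ≠ 0 → ρ r = θ c) ∧
      (∀ k l r c, coeffMat ((g : Matrix (Fin n) (Fin n) ℂ).map C * A *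
          ((h⁻¹ : GL (Fin n) ℂ) : Matrix (Fin n) (Fin n) ℂ).map C) (k, l) r c ≠ 0 →
          ρ r = θ c + st k l) ∧
      (∀ σ : Equiv.Perm (Fin m), ∃ k r, ρ r = st k (σ k)) ∧
      (∀ r k l, ρ r = st k l → ∃ c, θ c = st k l ∧
        constPart ((g : Matrix (Fin n) (Fin n) ℂ).map C * A *
          ((h⁻¹ : GL (Fin n) ℂ) : Matrix (Fin n) (Fin n) ℂ).map C) r c = 1) := by
  classical
  obtain ⟨P, Q, γ₀, hn0, hΛ, hkj, hγ₀, hK, hker, hmapker, htop, hserved⟩ := tightStructure_prep hm hA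
  set Λm : Matrix (Fin n) (Fin n) ℂ := constPart A with hΛm
  set pr : Fin m ⊕ Fin m → ℕ := primes₂ m with hpr
  have hc : ∀ x : Fin m ⊕ Fin m, ((fun x => (pr x : ℂ)) x) ≠ 0 := fun x => primes₂_cast_ne_zero m x
  let L₀ : Lift₂ (Matrix.toLin' Λm) (fun k j => Matrix.toLin' (coeffMat A (k, j))) 1 1
      (fun x => (pr x : ℂ)) :=
    lift₂OfMatrices Λm (fun k j => coeffMat A (k, j)) 1 1 _ hc P Q hΛ (fun k j => hkj k j)
  -- the torus datum for `σ = 1` (weights `wt`, unique factorisation)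
  let D : TorusData₂ m (Fin n → ℂ) :=
    { Λ := Matrix.toLin' Λm, A := fun k j => Matrix.toLin' (coeffMat A (k, j)), r := pr,
      prime := primes₂_prime m, r_inj := primes₂_injective m, L := L₀, γ₀ := γ₀, ker_le := hker,
      γ₀_ne := hγ₀ }
  let ind : Finset (Fin m) → Finset (Fin m) → Fin m ⊕ Fin m → ℕ := fun I J =>
    Sum.elim (fun k => if k ∈ I then 1 else 0) (fun j => if j ∈ J then 1 else 0)
  have hind01 : ∀ I J x, ind I J x ≤ 1 := by
    intro I J x; rcases x with k | j <;> simp only [ind, Sum.elim_inl, Sum.elim_inr] <;> split_ifs <;> omega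
  -- §2 the weights of pairs; present pairs; the tight count
  have hwtD : ∀ I J, D.wt (ind I J) = γ₀ * ∏ x, (pr x : ℂ) ^ ind I J x := fun I J => rfl
  have hind_inj : ∀ I J I' J', ind I J = ind I' J' → I = I' ∧ J = J' := fun I J I' J' h =>
    BorderApolarityToricWitnessObstructionQP.torusBound_ind_injective h
  have hwt_inj : ∀ I J I' J' : Finset (Fin m),
      (γ₀ * ∏ x, (pr x : ℂ) ^ ind I J x) = γ₀ * ∏ x, (pr x : ℂ) ^ ind I' J' x → I = I' ∧ J = J' := by
    intro I J I' J' h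
    rw [← hwtD, ← hwtD] at h
    exact hind_inj I J I' J' (D.wt_injective h)
  set Pl : Module.End ℂ (Fin n → ℂ) := Matrix.toLin' (P : Matrix (Fin n) (Fin n) ℂ) with hPl
  set W : Finset (Finset (Fin m) × Finset (Fin m)) :=
    univ.filter fun IJ => Pl.maxGenEigenspace (D.wt (ind IJ.1 IJ.2)) ≠ ⊥ with hW
  obtain ⟨hcnt1, hcnt2⟩ := stub_levelCard Pl (fun I J => D.wt (ind I J))
    (fun I J I' J' h => hind_inj I J I' J' (D.wt_injective h))
    (fun σ s hs1 hsm => by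
      obtain ⟨I, hI, hE⟩ := hserved σ s hs1 hsm
      exact ⟨I, hI, by rw [hwtD]; exact hE⟩)
  rw [Module.finrank_fin_fun] at hcnt2
  change W.card ≤ n at hcnt2
  have hWsub : (univ.filter fun IJ : Finset (Fin m) × Finset (Fin m) =>
      1 ≤ IJ.1.card ∧ Pl.maxGenEigenspace (D.wt (ind IJ.1 IJ.2)) ≠ ⊥) ⊆ W := by
    intro IJ hIJ
    rw [mem_filter] at hIJ ⊢
    exact ⟨hIJ.1, hIJ.2.2⟩
  have hWcard : W.card = n := by
    have := card_le_card hWsub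
    omega
  have hWeq : (univ.filter fun IJ : Finset (Fin m) × Finset (Fin m) =>
      1 ≤ IJ.1.card ∧ Pl.maxGenEigenspace (D.wt (ind IJ.1 IJ.2)) ≠ ⊥) = W :=
    eq_of_subset_of_card_le hWsub (by omega)
  have hWlev : ∀ IJ ∈ W, 1 ≤ IJ.1.card := by
    intro IJ hIJ
    rw [← hWeq, mem_filter] at hIJ
    exact hIJ.2.1
  have hWmem : ∀ IJ, IJ ∈ W ↔ Pl.maxGenEigenspace (D.wt (ind IJ.1 IJ.2)) ≠ ⊥ := fun IJ => by
    rw [hW, mem_filter]; exact ⟨fun h => h.2, fun h => ⟨mem_univ _, h⟩⟩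
  -- §3 the eigenbasis of `P` indexed by the present pairs
  set wt : ↥W → ℂ := fun i => D.wt (ind i.1.1 i.1.2) with hwt
  have hwtinj : Function.Injective wt := by
    rintro ⟨⟨I, J⟩, hi⟩ ⟨⟨I', J'⟩, hi'⟩ h
    obtain ⟨rfl, rfl⟩ := hind_inj I J I' J' (D.wt_injective h)
    rfl
  obtain ⟨b, hb, hsupp⟩ := stub_eigenbasis Pl wt hwtinj (fun i => (hWmem i.1).1 i.2)
    (by rw [Fintype.card_coe, hWcard, Module.finrank_fin_fun])
  -- §4 the top pair, the kernel line, the source basis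
  have htopmem : ((univ : Finset (Fin m)), (univ : Finset (Fin m))) ∈ W := by
    obtain ⟨I, hI, hE⟩ := hserved 1 m (by omega) le_rfl
    have hIu : I = univ := Finset.eq_univ_of_card I (by rw [hI, Fintype.card_fin])
    subst hIu
    rw [hWmem, hwtD]
    have : (univ : Finset (Fin m)).map (1 : Equiv.Perm (Fin m)).toEmbedding = univ := by
      ext x; simp
    rwa [this] at hE
  set top : ↥W := ⟨_, htopmem⟩ with htopdef
  obtain ⟨k₀, hk₀ne, hk₀span⟩ := finrank_eq_one_iff'.1 hK
  have hk₀ : (k₀ : Fin n → ℂ) ≠ 0 := fun h0 => hk₀ne (Subtype.ext h0)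
  have hkerk : ∀ v : Fin n → ℂ, Matrix.toLin' Λm v = 0 ↔ ∃ a : ℂ, v = a • (k₀ : Fin n → ℂ) := by
    intro v
    constructor
    · intro hv
      obtain ⟨c, hc⟩ := hk₀span ⟨v, hv⟩
      exact ⟨c, by have := congrArg Subtype.val hc; simpa using this.symm⟩
    · rintro ⟨a, rfl⟩
      rw [map_smul, show Matrix.toLin' Λm (k₀ : Fin n → ℂ) = 0 from k₀.2, smul_zero]
  set Ql : Module.End ℂ (Fin n → ℂ) := Matrix.toLin' (Q : Matrix (Fin n) (Fin n) ℂ) with hQl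
  have hCk : Ql k₀ = γ₀ • (k₀ : Fin n → ℂ) := by
    have hmem : Ql k₀ ∈ LinearMap.ker (Matrix.toLin' Λm) := by
      have h1 := Submodule.mem_map_of_mem (f := (L₀.C : (Fin n → ℂ) →ₗ[ℂ] (Fin n → ℂ))) k₀.2
      rw [L₀.map_ker_eq] at h1
      exact h1
    obtain ⟨a, ha⟩ := (hkerk _).1 hmem
    by_contra hne
    have haγ : a ≠ γ₀ := fun h => hne (by rw [ha, h])
    have h1 : (k₀ : Fin n → ℂ) ∈ Ql.maxGenEigenspace a := by
      apply Module.End.eigenspace_le_maxGenEigenspace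
      rw [Module.End.mem_eigenspace_iff]; exact ha
    have h2 : (k₀ : Fin n → ℂ) ∈ Ql.maxGenEigenspace γ₀ := hker k₀.2
    exact hk₀ ((Module.End.disjoint_genEigenspace Ql haγ ⊤ ⊤).le_bot ⟨h1, h2⟩)
  have hwttop : wt top = ((∏ k, (pr (Sum.inl k) : ℂ)) * ∏ j, (pr (Sum.inr j) : ℂ)) * γ₀ := by
    show γ₀ * ∏ x, (pr x : ℂ) ^ ind univ univ x = ((∏ k, (pr (Sum.inl k) : ℂ)) * ∏ j, (pr (Sum.inr j) : ℂ)) * γ₀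
    have : ∀ x, ind univ univ x = 1 := by
      intro x; rcases x with k | j <;> simp [ind]
    simp only [this, pow_one]
    rw [Fintype.prod_sum_type, mul_comm]
  have hbmem : ∀ i, b i ∈ Pl.maxGenEigenspace (wt i) := fun i =>
    Module.End.eigenspace_le_maxGenEigenspace (Module.End.mem_eigenspace_iff.2 (hb i))
  have hrange : ∀ i : ↥W, i ≠ top → b i ∈ LinearMap.range (Matrix.toLin' Λm) := by
    intro i hi
    have hne : wt i ≠ ((∏ k, (pr (Sum.inl k) : ℂ)) * ∏ j, (pr (Sum.inr j) : ℂ)) * γ₀ := by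
      rw [← hwttop]; exact fun h => hi (hwtinj h)
    exact htop _ hne (hbmem i)
  have hγne : ∀ i : ↥W, wt i ≠ γ₀ := by
    intro i h
    have h' : D.wt (ind i.1.1 i.1.2) = D.wt (ind ∅ ∅) := by
      rw [show ind ∅ ∅ = 0 from funext fun x => by rcases x with k | j <;> simp [ind], D.wt_zero]
      exact h
    have := (hind_inj _ _ _ _ (D.wt_injective h')).1
    have hl := hWlev i.1 i.2
    rw [this, card_empty] at hl
    omega
  have hcomm : Pl ∘ₗ Matrix.toLin' Λm = Matrix.toLin' Λm ∘ₗ Ql := by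
    rw [hPl, hQl, ← Matrix.toLin'_mul, ← Matrix.toLin'_mul, hΛ]
  obtain ⟨cs, hcs0, hcsΛ, hcsQ⟩ := stub_sourceBasis (Matrix.toLin' Λm) Pl Ql hcomm b wt hb γ₀ hγne
    (k₀ : Fin n → ℂ) hk₀ hkerk hCk top hrange
  -- §5 reindex both bases by `Fin n`; the change-of-basis matrices `g`, `h`
  have hcardW : Fintype.card ↥W = n := by rw [Fintype.card_coe, hWcard]
  have hcardC : Fintype.card (Option {i : ↥W // i ≠ top}) = n := by
    rw [Fintype.card_option, Fintype.card_subtype_compl, Fintype.card_subtype_eq, hcardW]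
    omega
  set eR : Fin n ≃ ↥W := Fintype.equivOfCardEq (by rw [Fintype.card_fin, hcardW]) with heR
  set eC : Fin n ≃ Option {i : ↥W // i ≠ top} :=
    Fintype.equivOfCardEq (by rw [Fintype.card_fin, hcardC]) with heC
  set br : Module.Basis (Fin n) ℂ (Fin n → ℂ) := b.reindex eR.symm with hbr
  set bc : Module.Basis (Fin n) ℂ (Fin n → ℂ) := cs.reindex eC.symm with hbc
  have hbr_apply : ∀ r, br r = b (eR r) := fun r => by
    rw [hbr, Module.Basis.reindex_apply, Equiv.symm_symm]
  have hbc_apply : ∀ c, bc c = cs (eC c) := fun c => by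
    rw [hbc, Module.Basis.reindex_apply, Equiv.symm_symm]
  have hbr_repr : ∀ v r, br.repr v r = b.repr v (eR r) := fun v r => by
    rw [hbr, Module.Basis.repr_reindex_apply, Equiv.symm_symm]
  set gm : Matrix (Fin n) (Fin n) ℂ := br.toMatrix (Pi.basisFun ℂ (Fin n)) with hgm
  set gim : Matrix (Fin n) (Fin n) ℂ := (Pi.basisFun ℂ (Fin n)).toMatrix br with hgim
  set hm' : Matrix (Fin n) (Fin n) ℂ := bc.toMatrix (Pi.basisFun ℂ (Fin n)) with hhm'
  set him : Matrix (Fin n) (Fin n) ℂ := (Pi.basisFun ℂ (Fin n)).toMatrix bc with hhim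
  let g : GL (Fin n) ℂ := ⟨gm, gim, Module.Basis.toMatrix_mul_toMatrix_flip _ _,
    Module.Basis.toMatrix_mul_toMatrix_flip _ _⟩
  let h : GL (Fin n) ℂ := ⟨hm', him, Module.Basis.toMatrix_mul_toMatrix_flip _ _,
    Module.Basis.toMatrix_mul_toMatrix_flip _ _⟩
  have hginv : ((h⁻¹ : GL (Fin n) ℂ) : Matrix (Fin n) (Fin n) ℂ) = him := rfl
  have hgval : ((g : GL (Fin n) ℂ) : Matrix (Fin n) (Fin n) ℂ) = gm := rfl
  -- the entries of `g M h⁻¹` are coordinates in the basis `br` of `M` applied to the basis `bc`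
  have hentry : ∀ (M : Matrix (Fin n) (Fin n) ℂ) (r c : Fin n),
      (gm * M * him) r c = br.repr (Matrix.toLin' M (bc c)) r := by
    intro M r c
    have hcol : (fun j => him j c) = bc c := by
      funext j
      rw [hhim, Module.Basis.toMatrix_apply, Pi.basisFun_repr]
    have h1 : (gm * M * him) r c = ((gm * M) *ᵥ (fun j => him j c)) r := by
      simp only [Matrix.mul_apply, Matrix.mulVec, dotProduct]
    rw [h1, hcol, ← Matrix.mulVec_mulVec, Matrix.toLin'_apply]
    have h2 : gm *ᵥ (M *ᵥ bc c) = ⇑(br.repr (M *ᵥ bc c)) := by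
      have := Module.Basis.toMatrix_mulVec_repr (Pi.basisFun ℂ (Fin n)) br (M *ᵥ bc c)
      rw [← hgm] at this
      rw [← this]
      congr 1
    rw [h2]
  -- §6 exponents of rows and columns
  set ρ : Fin n → (Fin m ⊕ Fin m → ℕ) := fun r => ind (eR r).1.1 (eR r).1.2 with hρ
  set θ : Fin n → (Fin m ⊕ Fin m → ℕ) := fun c =>
    (eC c).elim 0 (fun i => ind i.1.1.1 i.1.1.2) with hθ
  have hwtρ : ∀ r, wt (eR r) = D.wt (ρ r) := fun r => rfl
  have hQbc : ∀ c, Ql (bc c) = D.wt (θ c) • bc c := by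
    intro c
    rw [hbc_apply]
    simp only [hθ]
    rcases hec : eC c with _ | i
    · rw [Option.elim_none, D.wt_zero, hcs0]; exact hCk
    · rw [Option.elim_some]; exact hcsQ i
  have hind_top : ∀ x, ind univ univ x = 1 := by
    intro x; rcases x with k | j <;> simp [ind]
  haveI : Nontrivial (Fin m) := Fin.nontrivial_iff_two_le.mpr (by omega)
  refine ⟨g, h, ρ, θ, eC.symm none, fun r x => hind01 _ _ x, ?_, ?_, ?_, ?_, ?_, ?_, ?_⟩
  · -- `θ` is `0/1`-valued
    intro c x
    simp only [hθ]
    rcases eC c with _ | i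
    · simp
    · rw [Option.elim_some]; exact hind01 _ _ x
  · -- `θ` is injective
    intro c c' hcc
    simp only [hθ] at hcc
    apply eC.injective
    generalize hec : eC c = o at hcc ⊢
    generalize hec' : eC c' = o' at hcc ⊢
    have key : ∀ i' : {i : ↥W // i ≠ top}, (0 : Fin m ⊕ Fin m → ℕ) ≠ ind i'.1.1.1 i'.1.1.2 := by
      intro i' h0
      obtain ⟨a, ha⟩ := Finset.card_pos.1 (hWlev i'.1.1 i'.1.2)
      have h1 := congrFun h0 (Sum.inl a)
      simp [ind, ha] at h1
    rcases o with _ | i <;> rcases o' with _ | i'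
    · rfl
    · exact absurd hcc (by rw [Option.elim_none, Option.elim_some]; exact key i')
    · exact absurd hcc.symm (by rw [Option.elim_none, Option.elim_some]; exact key i)
    · rw [Option.elim_some, Option.elim_some] at hcc
      obtain ⟨h1, h2⟩ := hind_inj _ _ _ _ hcc
      have : i.1.1 = i'.1.1 := Prod.ext h1 h2
      rw [Subtype.ext (Subtype.ext this)]
  · -- the pivot column
    simp only [hθ]
    rw [Equiv.apply_symm_apply, Option.elim_none]
  · -- constant entries respect the grading
    intro r c hne
    rw [hginv, hgval, constPart_mul, constPart_mul, constPart_map_C, constPart_map_C, hentry,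
      hbc_apply] at hne
    simp only [hθ]
    generalize hec : eC c = o at hne ⊢
    rcases o with _ | i
    · exfalso
      apply hne
      rw [hcs0, show Matrix.toLin' Λm (k₀ : Fin n → ℂ) = 0 from k₀.2, map_zero, Finsupp.zero_apply]
    · rw [hcsΛ, ← Equiv.apply_symm_apply eR i.1, ← hbr_apply, br.repr_self, Finsupp.single_apply] at hne
      have hr : eR.symm i.1 = r := by by_contra hri; exact hne (if_neg hri)
      rw [Option.elim_some]
      simp only [hρ]
      rw [← hr, Equiv.apply_symm_apply]
  · -- `x_{kl}`-entries shift the grading by `st k l`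
    intro k l r c hne
    rw [hginv, hgval, coeffMat_C_mul_mul_C, hentry, hbr_repr] at hne
    set v : Fin n → ℂ := Matrix.toLin' (coeffMat A (k, l)) (bc c) with hv
    have hPv : Pl v = ((pr (Sum.inl k) : ℂ) * pr (Sum.inr l) * D.wt (θ c)) • v := by
      rw [hv, hPl, ← Matrix.toLin'_mul_apply, hkj, map_smul, LinearMap.smul_apply,
        Matrix.toLin'_mul_apply, ← hQl, hQbc, map_smul, smul_smul]
    have hμ : D.wt (θ c + st k l) = (pr (Sum.inl k) : ℂ) * pr (Sum.inr l) * D.wt (θ c) := by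
      rw [D.wt_add_st]
    have hvmem : v ∈ Pl.maxGenEigenspace (D.wt (θ c + st k l)) := by
      rw [hμ]
      exact Module.End.eigenspace_le_maxGenEigenspace (Module.End.mem_eigenspace_iff.2 hPv)
    have := hsupp _ v hvmem (eR r) hne
    rw [hwtρ] at this
    exact (D.wt_injective this).symm
  · -- the level-1 rows serve every permutation
    intro σ
    obtain ⟨I, hI, hE⟩ := hserved σ 1 le_rfl (by omega)
    obtain ⟨a, rfl⟩ := Finset.card_eq_one.1 hI
    have hmem : (({a} : Finset (Fin m)), ({a} : Finset (Fin m)).map σ.toEmbedding) ∈ W := by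
      rw [hWmem, hwtD]; exact hE
    refine ⟨a, eR.symm ⟨_, hmem⟩, ?_⟩
    simp only [hρ]
    rw [Equiv.apply_symm_apply]
    show ind {a} (({a} : Finset (Fin m)).map σ.toEmbedding) = st a (σ a)
    rw [Finset.map_singleton]
    funext x
    rcases x with k | j
    · simp [ind, st_apply]
    · simp [ind, st_apply]
  · -- level-1 rows have their unit diagonal constant
    intro r k l hrkl
    have hne : eR r ≠ top := by
      intro heq
      obtain ⟨l', hl'⟩ := exists_ne l
      have h1 := congrFun hrkl (Sum.inr l')
      simp only [hρ] at h1
      rw [heq, hind_top, st_apply_of_ne Sum.inr_ne_inl (fun h => hl' (Sum.inr_injective h))] at h1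
      exact one_ne_zero h1
    refine ⟨eC.symm (some ⟨eR r, hne⟩), ?_, ?_⟩
    · simp only [hθ]
      rw [Equiv.apply_symm_apply, Option.elim_some]
      exact hrkl
    · rw [hginv, hgval, constPart_mul, constPart_mul, constPart_map_C, constPart_map_C, hentry, hbc_apply,
        Equiv.apply_symm_apply, hcsΛ]
      show br.repr (b (eR r)) r = 1
      rw [← hbr_apply r, br.repr_self, Finsupp.single_eq_same]

end

end Summit.ValiantsHypothesis.ValiantsHypothesis.Theorems.RigidityForcesSymmetryRigidMinimalRepr
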